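import Summits.RiemannHypothesis.RiemannHypothesis.Theorems.PfPersistencePerronFakeNodelessEvenKernel
import HarnessLib

/-!
# PF persistence — PERRON-FAKE (S6), part 5c: the FOLD-GAIN LAWS
# (explicit lower bounds for `Q(u) − Q(|u|)` on the window class of an ARBITRARY real table;
# the full windowed form is sign-improving on `(0, 1/8]` and even-sign-improving on `(0, 11/40]`)

`pub-rhpf` cell, unit `pub-rhpf-prover-perron` (S6; CASE-DAG §6 row PERRON-FAKE; leaves G1.01 / G1.02,
FAKE column; table-side reading of leaf G1.19).  **Mechanism / rigidity campaign; no RH claims.**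
RH-free, definition-free: Mathlib + proved tree files only.

Parts 4 and 5b prove that a member of the finite-energy window class `coreAdm a` which folding
`u ↦ |u|` does NOT LOWER is a.e. one-signed (every real table; `0 < a ≤ 1/8`, resp. even members and
`0 < a ≤ 11/40`).  The same integrated lobe balance gives more, and this file records it as a
quantitative law with NO hypothesis on the sign behaviour of `u`: for every real table `w`, every
window with `2a < log 2` and every real `u ∈ coreAdm a`, writing `m₊ = ∫u⁺`, `m₋ = ∫u⁻`,

* `foldGain_ge`:      `4·(ρ(2a) − 2cosh a)·m₊·m₋ ≤ Q^w_a(u) − Q^w_a(|u|)`;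
* `evenFoldGain_ge`:  `4·(ρ(a) − 1 − cosh a)·m₊·m₋ ≤ Q^w_a(u) − Q^w_a(|u|)` for EVEN `u` (`0 < a`);

(`ρ = weilArchDensity`, `Q^w_a = tableClosedForm a w`).  Both follow from one balance
`foldGain_ge_of_channels`: by the lobe-balance law (part 1) `Q(u) − Q(|u|) = 4∫u⁻·S_u`; below
`log 2/2` no prime length enters the window, so the atomic part of the source vanishes against `u⁻`
and the table drops out; a polar bound `2∫u⁺(x)cosh((x−y)/2)dx ≤ R·m₊` on the window and an
archimedean bound `K·m₊·m₋ ≤ ∫u⁻·(ρ-pairing of u⁺)` give `4(K − R)m₊m₋ ≤ Q(u) − Q(|u|)`.  The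
parity-free channel (`K = ρ(2a)`, part 4's comparison, isolated here as `archPairing_ge`;
`R = 2cosh a`) and the even channel (`K = ρ(a)`, part 5a `archPairing_ge_of_even`; `R = 1 + cosh a`
by the even polar factorisation of part 2) are the two instances.

Consequences (PROVED): with the tree numerics of parts 4 / 5a the constants are positive on
`0 < a ≤ 1/8`, resp. `0 < a ≤ 11/40`, so there the full windowed form of EVERY real table is
SIGN-IMPROVING on the finite-energy class — `tableClosedForm_abs_le_smallWindow`:
`Q^w_a(|u|) ≤ Q^w_a(u)`, and `tableClosedForm_abs_le_of_even_evenWindow` for even `u` — and the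
one-signedness theorems of parts 4 / 5b are the equality case.  HONEST SCOPE: table-blind statements
far below every served window (`ζ` census from `a = 0.30`; cells `[0.40, 1.65]`); the constants change
sign at `a ≈ 0.1406` resp. `a ≈ 0.2782` (DERIVED) and the laws say nothing beyond; on the `ζ` side the
tree PROVES the form is not sign-improving from `a = 3/10` (even: `33/100`) on
(`sw_not_signImproving_of_ge`, `swe_even_not_signImproving_of_ge`).  Nothing here is a statement
about positivity of any form.

References (mechanism only): R. Jentzsch, J. reine angew. Math. 141 (1912) 235–244; M. Reed and
B. Simon, Methods of Modern Mathematical Physics IV (1978) §XIII.12 (Beurling–Deny criteria);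
E. Bombieri, "Problems of the Millennium: the Riemann Hypothesis" (2000), Thm 2 (explicit formula).
-/

set_option linter.dupNamespace false  -- the mandated namespace repeats `RiemannHypothesis`

open MeasureTheory Set Filter Complex
open scoped Real Topology

namespace Summit.RiemannHypothesis.RiemannHypothesis.Theorems.PfPersistence

open Literature.NumberTheory.LFunctions
open Summit.RiemannHypothesis.RiemannHypothesis.Theorems.WeilGroundStateMarkovPart
open Summit.RiemannHypothesis.RiemannHypothesis.Theorems.PolarPerronFrobenius

section FoldGain

variable {a : ℝ} {u : ℝ → ℝ}

/-- **Parity-free archimedean channel (PROVED; part 4's comparison, isolated).**  For a real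
square-integrable `u` supported in `[-a, a]` with finite archimedean energies of `u` and `|u|`:
`ρ(2a)·(∫u⁺)(∫u⁻) ≤ ∫ u⁻(y) ∫_{t>0} ρ(t)(u⁺(y+t) + u⁺(y−t)) dt dy` — two window points are at distance
at most `2a` and `ρ` is decreasing. [folklore] -/
theorem archPairing_ge (hum : Measurable u) (hu2 : MemLp u 2 volume)
    (hus' : ∀ x : ℝ, x ∉ Icc (-a) a → u x = 0)
    (hE : IntegrableOn (fun t ↦ weilArchDensity t * weilIncrement (fun x ↦ ((u x : ℝ) : ℂ)) t) (Ioi 0))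
    (hEA : IntegrableOn
      (fun t ↦ weilArchDensity t * weilIncrement (fun x ↦ ((|u x| : ℝ) : ℂ)) t) (Ioi 0)) :
    weilArchDensity (2 * a) * ((∫ x, max (u x) 0) * ∫ x, max (-u x) 0) ≤
      ∫ y, max (-u y) 0 *
        ∫ t in Ioi (0 : ℝ), weilArchDensity t * (max (u (y + t)) 0 + max (u (y - t)) 0) := by
  have hus : ∀ᵐ x : ℝ, x ∉ Icc (-a) a → u x = 0 := Eventually.of_forall hus'
  have hp1 : Integrable fun x ↦ max (u x) 0 :=
    swg_integrable_of_memLp (swg_memLp_posPart hu2) (swg_posPart_ae_zero hus)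
  have hn1 : Integrable fun x ↦ max (-u x) 0 :=
    swg_integrable_of_memLp (swg_memLp_negPart hu2) (swg_negPart_ae_zero hus)
  obtain ⟨harch, -⟩ := swg_archGain_eq hum hu2 hE hEA
  -- the integrand on `(t, x)`
  set F : ℝ × ℝ → ℝ := fun q ↦ max (-u q.2) 0 * (max (u (q.2 + q.1)) 0 + max (u (q.2 - q.1)) 0)
    with hF
  have hpm : Measurable fun x ↦ max (u x) 0 := hum.max measurable_const
  have hnm : Measurable fun x ↦ max (-u x) 0 := hum.neg.max measurable_const
  have hFm : Measurable F :=
    (hnm.comp measurable_snd).mul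
      ((hpm.comp (measurable_snd.add measurable_fst)).add (hpm.comp (measurable_snd.sub measurable_fst)))
  have hF0 : ∀ q, 0 ≤ F q := fun q ↦
    mul_nonneg (le_max_right _ _) (add_nonneg (le_max_right _ _) (le_max_right _ _))
  have hfib : ∀ x, Integrable (fun t ↦ F (t, x)) (volume.restrict (Ioi 0)) := fun x ↦
    (((hp1.comp_add_left x).add (hp1.comp_sub_left x)).const_mul (max (-u x) 0)).restrict
  have hfibint : ∀ x, ∫ t in Ioi (0 : ℝ), F (t, x) = max (-u x) 0 * ∫ s, max (u s) 0 := by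
    intro x
    simp only [hF]
    rw [integral_const_mul, integral_Ioi_add_sub_eq hp1 x]
  have hFint : Integrable F ((volume.restrict (Ioi (0 : ℝ))).prod volume) := by
    refine (integrable_prod_iff' hFm.aestronglyMeasurable).2 ⟨Eventually.of_forall hfib, ?_⟩
    have e : (fun x ↦ ∫ t in Ioi (0 : ℝ), ‖F (t, x)‖) = fun x ↦ max (-u x) 0 * ∫ s, max (u s) 0 := by
      funext x
      rw [← hfibint x]
      exact integral_congr_ae (Eventually.of_forall fun t ↦ Real.norm_of_nonneg (hF0 _))
    rw [e]
    exact hn1.mul_const _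
  have hGint : Integrable (fun t ↦ ∫ x, F (t, x)) (volume.restrict (Ioi 0)) :=
    hFint.integral_prod_left
  have hGval : ∫ t in Ioi (0 : ℝ), ∫ x, F (t, x) = (∫ x, max (u x) 0) * ∫ x, max (-u x) 0 := by
    have hsw := integral_integral_swap (μ := volume.restrict (Ioi (0 : ℝ))) (ν := volume)
      (f := fun t x ↦ F (t, x)) hFint
    rw [hsw]
    have e : (fun x ↦ ∫ t in Ioi (0 : ℝ), F (t, x)) = fun x ↦ max (-u x) 0 * ∫ s, max (u s) 0 :=
      funext hfibint
    rw [e, integral_mul_const, mul_comm]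
  have hG : ∀ t, weilIncrement (fun x ↦ ((u x : ℝ) : ℂ)) t -
      weilIncrement (fun x ↦ ((|u x| : ℝ) : ℂ)) t = 4 * ∫ x, F (t, x) := by
    intro t
    rw [swg_weilIncrement_sub_abs hu2 t]
  -- pointwise comparison on `(0, ∞)`: `ρ(t) ≥ ρ(2a)` where the gain lives (`t ≤ 2a`)
  have hlow : ∫ t in Ioi (0 : ℝ), weilArchDensity (2 * a) * (4 * ∫ x, F (t, x)) ≤
      ∫ t in Ioi (0 : ℝ), weilArchDensity t * (weilIncrement (fun x ↦ ((u x : ℝ) : ℂ)) t -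
        weilIncrement (fun x ↦ ((|u x| : ℝ) : ℂ)) t) := by
    refine setIntegral_mono_on ((hGint.const_mul 4).const_mul _)
      ((hE.sub hEA).congr (Eventually.of_forall fun t ↦ (mul_sub _ _ _).symm)) measurableSet_Ioi
      fun t ht ↦ ?_
    have ht0 : 0 < t := ht
    rw [hG t]
    by_cases ht2 : t ≤ 2 * a
    · exact mul_le_mul_of_nonneg_right
        (weilArchDensity_antitoneOn (mem_Ioi.2 ht0) (mem_Ioi.2 (ht0.trans_le ht2)) ht2)
        (mul_nonneg (by norm_num) (integral_nonneg fun x ↦ hF0 _))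
    · have hzero : ∫ x, F (t, x) = 0 := by
        refine integral_eq_zero_of_ae (Eventually.of_forall fun x ↦ ?_)
        simp only [hF, Pi.zero_apply]
        by_cases hx : x ∈ Icc (-a) a
        · push Not at ht2
          have h1 : x + t ∉ Icc (-a) a := fun h ↦ by linarith [h.2, hx.1]
          have h2 : x - t ∉ Icc (-a) a := fun h ↦ by linarith [h.1, hx.2]
          rw [hus' _ h1, hus' _ h2, max_self, add_zero, mul_zero]
        · rw [hus' x hx, neg_zero, max_self, zero_mul]
      rw [hzero, mul_zero, mul_zero, mul_zero]
  have h := hlow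
  rw [harch, integral_const_mul, integral_const_mul, hGval] at h
  linarith

/-- **The fold-gain balance (PROVED).**  For every real table `w`, every window with `2a < log 2`
and every real `u ∈ coreAdm a`: a polar bound `2∫u⁺(x)cosh((x−y)/2)dx ≤ R·∫u⁺` on the window and an
archimedean bound `K·(∫u⁺)(∫u⁻) ≤ ∫u⁻·(ρ-pairing of u⁺)` give
`4(K − R)(∫u⁺)(∫u⁻) ≤ Q^w_a(u) − Q^w_a(|u|)` — the table's atomic part does not act below `log 2/2`.
[folklore] -/
theorem foldGain_ge_of_channels (w : ℕ → ℝ) (hum : Measurable u)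
    (hU : coreAdm a (fun x ↦ ((u x : ℝ) : ℂ))) (h2a : 2 * a < Real.log 2) {R K : ℝ}
    (hR : ∀ y ∈ Icc (-a) a,
      2 * ∫ x, max (u x) 0 * Real.cosh ((x - y) / 2) ≤ R * ∫ x, max (u x) 0)
    (hK : K * ((∫ x, max (u x) 0) * ∫ x, max (-u x) 0) ≤
      ∫ y, max (-u y) 0 *
        ∫ t in Ioi (0 : ℝ), weilArchDensity t * (max (u (y + t)) 0 + max (u (y - t)) 0)) :
    4 * ((K - R) * ((∫ x, max (u x) 0) * ∫ x, max (-u x) 0)) ≤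
      tableClosedForm a w (fun x ↦ ((u x : ℝ) : ℂ)) -
        tableClosedForm a w (fun x ↦ ((|u x| : ℝ) : ℂ)) := by
  set U : ℝ → ℂ := fun x ↦ ((u x : ℝ) : ℂ) with hUdef
  set A : ℝ → ℂ := fun x ↦ ((|u x| : ℝ) : ℂ) with hAdef
  have hU2 : MemLp U 2 volume := hU.1
  have hu2 : MemLp u 2 volume :=
    MemLp.of_le hU2 hum.aestronglyMeasurable (Eventually.of_forall fun x ↦ by simp [hUdef])
  have hus' : ∀ x : ℝ, x ∉ Icc (-a) a → u x = 0 := fun x hx ↦ by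
    have h := hU.2.1 x hx
    simpa [hUdef] using h
  have hus : ∀ᵐ x : ℝ, x ∉ Icc (-a) a → u x = 0 := Eventually.of_forall hus'
  have hn1 : Integrable fun x ↦ max (-u x) 0 :=
    swg_integrable_of_memLp (swg_memLp_negPart hu2) (swg_negPart_ae_zero hus)
  have hE : IntegrableOn (fun t ↦ weilArchDensity t * weilIncrement U t) (Ioi 0) := hU.2.2
  have hAeq : (fun x ↦ ((‖U x‖ : ℝ) : ℂ)) = A := by
    funext x; simp [hUdef, hAdef]
  have hEA : IntegrableOn (fun t ↦ weilArchDensity t * weilIncrement A t) (Ioi 0) := by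
    have h := finiteEnergy_norm hU2 hE
    rwa [hAeq] at h
  obtain ⟨-, hIJ⟩ := swg_archGain_eq hum hu2 hE hEA
  -- (1) the lobe-balance law of part 1
  obtain ⟨hid, hIS⟩ := tableClosedForm_abs_sub_eq_source w hum hU
    (fun y ↦ (∫ t in Ioi (0 : ℝ), weilArchDensity t * (max (u (y + t)) 0 + max (u (y - t)) 0)) +
      (∑ n ∈ weilPrimeIndex a, w n * (max (u (y + Real.log n)) 0 + max (u (y - Real.log n)) 0)) -
      2 * ∫ x, max (u x) 0 * Real.cosh ((x - y) / 2)) (fun y ↦ rfl)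
  -- (2) the atomic part vanishes against `u⁻` (no prime length enters the window)
  have hlog0 : ∀ n ∈ weilPrimeIndex a, Real.log (n : ℝ) = 0 := by
    intro n hn
    have hlt : Real.log (n : ℝ) < Real.log 2 := (mem_weilPrimeIndex.1 hn).trans h2a
    have hn2 : n < 2 := by
      by_contra h
      push Not at h
      have h' : (2 : ℝ) ≤ n := by exact_mod_cast h
      have : Real.log 2 ≤ Real.log (n : ℝ) := Real.log_le_log (by norm_num) h'
      linarith
    interval_cases n <;> simp
  have hP0 : ∀ y, max (-u y) 0 *
      (∑ n ∈ weilPrimeIndex a, w n * (max (u (y + Real.log n)) 0 + max (u (y - Real.log n)) 0)) =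
        0 := by
    intro y
    have hpm : max (-u y) 0 * max (u y) 0 = 0 := by
      rcases le_total 0 (u y) with h | h
      · rw [max_eq_right (by linarith : -u y ≤ 0), zero_mul]
      · rw [max_eq_right h, mul_zero]
    rw [Finset.mul_sum]
    refine Finset.sum_eq_zero fun n hn ↦ ?_
    rw [hlog0 n hn, add_zero, sub_zero]
    calc max (-u y) 0 * (w n * (max (u y) 0 + max (u y) 0))
        = 2 * w n * (max (-u y) 0 * max (u y) 0) := by ring
      _ = 0 := by rw [hpm, mul_zero]
  -- (3) the polar channel against `u⁻`
  have hRle : ∀ y, max (-u y) 0 * (2 * ∫ x, max (u x) 0 * Real.cosh ((x - y) / 2)) ≤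
      max (-u y) 0 * (R * ∫ x, max (u x) 0) := by
    intro y
    by_cases hy : y ∈ Icc (-a) a
    · exact mul_le_mul_of_nonneg_left (hR y hy) (le_max_right _ _)
    · simp only [hus' y hy, neg_zero, max_self, zero_mul, le_refl]
  -- (4) assemble
  have hcomb : ∫ y, (max (-u y) 0 *
      (∫ t in Ioi (0 : ℝ), weilArchDensity t * (max (u (y + t)) 0 + max (u (y - t)) 0)) -
        max (-u y) 0 * (R * ∫ x, max (u x) 0)) ≤
      ∫ y, max (-u y) 0 *
        ((∫ t in Ioi (0 : ℝ), weilArchDensity t * (max (u (y + t)) 0 + max (u (y - t)) 0)) +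
          (∑ n ∈ weilPrimeIndex a, w n * (max (u (y + Real.log n)) 0 + max (u (y - Real.log n)) 0)) -
          2 * ∫ x, max (u x) 0 * Real.cosh ((x - y) / 2)) := by
    refine integral_mono (hIJ.sub (hn1.mul_const _)) hIS fun y ↦ ?_
    have h1 := hP0 y
    have h2 := hRle y
    simp only
    rw [mul_sub, mul_add, h1, add_zero]
    linarith
  rw [integral_sub hIJ (hn1.mul_const _), integral_mul_const] at hcomb
  linarith [hid, hK, hcomb]

/-- **Parity-free fold-gain law (PROVED).**  Every real table `w`, every window with `2a < log 2`,
every real `u ∈ coreAdm a`: `4·(ρ(2a) − 2cosh a)·(∫u⁺)(∫u⁻) ≤ Q^w_a(u) − Q^w_a(|u|)`. [folklore] -/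
theorem foldGain_ge (w : ℕ → ℝ) (hum : Measurable u) (hU : coreAdm a (fun x ↦ ((u x : ℝ) : ℂ)))
    (h2a : 2 * a < Real.log 2) :
    4 * ((weilArchDensity (2 * a) - 2 * Real.cosh a) * ((∫ x, max (u x) 0) * ∫ x, max (-u x) 0)) ≤
      tableClosedForm a w (fun x ↦ ((u x : ℝ) : ℂ)) -
        tableClosedForm a w (fun x ↦ ((|u x| : ℝ) : ℂ)) := by
  have hU2 : MemLp (fun x ↦ ((u x : ℝ) : ℂ)) 2 volume := hU.1
  have hu2 : MemLp u 2 volume :=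
    MemLp.of_le hU2 hum.aestronglyMeasurable (Eventually.of_forall fun x ↦ by simp)
  have hus' : ∀ x : ℝ, x ∉ Icc (-a) a → u x = 0 := fun x hx ↦ by
    have h := hU.2.1 x hx
    simpa using h
  have hus : ∀ᵐ x : ℝ, x ∉ Icc (-a) a → u x = 0 := Eventually.of_forall hus'
  have hp1 : Integrable fun x ↦ max (u x) 0 :=
    swg_integrable_of_memLp (swg_memLp_posPart hu2) (swg_posPart_ae_zero hus)
  have hE : IntegrableOn
      (fun t ↦ weilArchDensity t * weilIncrement (fun x ↦ ((u x : ℝ) : ℂ)) t) (Ioi 0) := hU.2.2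
  have hEA : IntegrableOn
      (fun t ↦ weilArchDensity t * weilIncrement (fun x ↦ ((|u x| : ℝ) : ℂ)) t) (Ioi 0) := by
    have h := finiteEnergy_norm hU2 hE
    have hAeq : (fun x ↦ (((‖((u x : ℝ) : ℂ)‖ : ℝ)) : ℂ)) = fun x ↦ ((|u x| : ℝ) : ℂ) := by
      funext x; simp
    simpa only [hAeq] using h
  -- polar channel: `cosh((x−y)/2) ≤ cosh a` on the window
  have hcont : ∀ y, Continuous fun x : ℝ ↦ Real.cosh ((x - y) / 2) := fun y ↦
    Real.continuous_cosh.comp ((continuous_id.sub continuous_const).div_const 2)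
  have hR : ∀ y ∈ Icc (-a) a,
      2 * ∫ x, max (u x) 0 * Real.cosh ((x - y) / 2) ≤ 2 * Real.cosh a * ∫ x, max (u x) 0 := by
    intro y hy
    have ha0 : 0 ≤ a := by
      have := hy.1.trans hy.2
      linarith
    rw [show 2 * Real.cosh a * ∫ x, max (u x) 0 = 2 * ∫ x, max (u x) 0 * Real.cosh a by
      rw [integral_mul_const]; ring]
    refine mul_le_mul_of_nonneg_left (integral_mono
      (swg_integrable_mul_continuous hp1 (swg_posPart_ae_zero hus) (hcont y)) (hp1.mul_const _)
      fun x ↦ ?_) two_pos.le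
    by_cases hx : x ∈ Icc (-a) a
    · refine mul_le_mul_of_nonneg_left ?_ (le_max_right _ _)
      rw [Real.cosh_le_cosh, abs_of_nonneg ha0, abs_le]
      constructor
      · linarith [hx.1, hy.2]
      · linarith [hx.2, hy.1]
    · simp only [hus' x hx, max_self, zero_mul, le_refl]
  exact foldGain_ge_of_channels w hum hU h2a hR (archPairing_ge hum hu2 hus' hE hEA)

/-- **Even fold-gain law (PROVED).**  Every real table `w`, every window `0 < a` with `2a < log 2`,
every real EVEN `u ∈ coreAdm a`: `4·(ρ(a) − 1 − cosh a)·(∫u⁺)(∫u⁻) ≤ Q^w_a(u) − Q^w_a(|u|)`.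
[folklore] -/
theorem evenFoldGain_ge (w : ℕ → ℝ) (hum : Measurable u) (hU : coreAdm a (fun x ↦ ((u x : ℝ) : ℂ)))
    (he : ∀ x, u (-x) = u x) (ha0 : 0 < a) (h2a : 2 * a < Real.log 2) :
    4 * ((weilArchDensity a - (1 + Real.cosh a)) * ((∫ x, max (u x) 0) * ∫ x, max (-u x) 0)) ≤
      tableClosedForm a w (fun x ↦ ((u x : ℝ) : ℂ)) -
        tableClosedForm a w (fun x ↦ ((|u x| : ℝ) : ℂ)) := by
  have hU2 : MemLp (fun x ↦ ((u x : ℝ) : ℂ)) 2 volume := hU.1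
  have hu2 : MemLp u 2 volume :=
    MemLp.of_le hU2 hum.aestronglyMeasurable (Eventually.of_forall fun x ↦ by simp)
  have hus' : ∀ x : ℝ, x ∉ Icc (-a) a → u x = 0 := fun x hx ↦ by
    have h := hU.2.1 x hx
    simpa using h
  have hus : ∀ᵐ x : ℝ, x ∉ Icc (-a) a → u x = 0 := Eventually.of_forall hus'
  have hp1 : Integrable fun x ↦ max (u x) 0 :=
    swg_integrable_of_memLp (swg_memLp_posPart hu2) (swg_posPart_ae_zero hus)
  have hE : IntegrableOn
      (fun t ↦ weilArchDensity t * weilIncrement (fun x ↦ ((u x : ℝ) : ℂ)) t) (Ioi 0) := hU.2.2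
  have hEA : IntegrableOn
      (fun t ↦ weilArchDensity t * weilIncrement (fun x ↦ ((|u x| : ℝ) : ℂ)) t) (Ioi 0) := by
    have h := finiteEnergy_norm hU2 hE
    have hAeq : (fun x ↦ (((‖((u x : ℝ) : ℂ)‖ : ℝ)) : ℂ)) = fun x ↦ ((|u x| : ℝ) : ℂ) := by
      funext x; simp
    simpa only [hAeq] using h
  -- even polar channel: `2∫u⁺(x)cosh((x−y)/2)dx = 2cosh(y/2)∫u⁺cosh(x/2) ≤ (1 + cosh a)·∫u⁺`
  have hcosh2 : Continuous fun x : ℝ ↦ Real.cosh (x / 2) :=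
    Real.continuous_cosh.comp (continuous_id.div_const 2)
  have hC0 : 0 ≤ ∫ x, max (u x) 0 * Real.cosh (x / 2) :=
    integral_nonneg fun x ↦ mul_nonneg (le_max_right _ _) (Real.cosh_pos _).le
  have hCle : ∫ x, max (u x) 0 * Real.cosh (x / 2) ≤ Real.cosh (a / 2) * ∫ x, max (u x) 0 := by
    rw [show Real.cosh (a / 2) * ∫ x, max (u x) 0 = ∫ x, max (u x) 0 * Real.cosh (a / 2) by
      rw [integral_mul_const]; ring]
    refine integral_mono (swg_integrable_mul_continuous hp1 (swg_posPart_ae_zero hus) hcosh2)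
      (hp1.mul_const _) fun x ↦ ?_
    by_cases hx : x ∈ Icc (-a) a
    · refine mul_le_mul_of_nonneg_left ?_ (le_max_right _ _)
      rw [Real.cosh_le_cosh, abs_of_nonneg (by linarith : 0 ≤ a / 2), abs_le]
      constructor <;> linarith [hx.1, hx.2]
    · simp only [hus' x hx, max_self, zero_mul, le_refl]
  have hsq : 2 * Real.cosh (a / 2) ^ 2 = 1 + Real.cosh a := by
    rw [swe_two_mul_cosh_sq, show 2 * (a / 2) = a by ring]
  have hR : ∀ y ∈ Icc (-a) a,
      2 * ∫ x, max (u x) 0 * Real.cosh ((x - y) / 2) ≤ (1 + Real.cosh a) * ∫ x, max (u x) 0 := by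
    intro y hy
    rw [integral_posPart_mul_cosh_of_even hu2 hus he y]
    have hcy : Real.cosh (y / 2) ≤ Real.cosh (a / 2) := by
      rw [Real.cosh_le_cosh, abs_of_nonneg (by linarith : 0 ≤ a / 2), abs_le]
      constructor <;> linarith [hy.1, hy.2]
    have h4 := mul_le_mul hcy hCle hC0 (Real.cosh_pos _).le
    calc 2 * (Real.cosh (y / 2) * ∫ x, max (u x) 0 * Real.cosh (x / 2))
        ≤ 2 * (Real.cosh (a / 2) * (Real.cosh (a / 2) * ∫ x, max (u x) 0)) := by linarith
      _ = (1 + Real.cosh a) * ∫ x, max (u x) 0 := by rw [← hsq]; ring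
  exact foldGain_ge_of_channels w hum hU h2a hR (archPairing_ge_of_even hum hu2 hus' he ha0 hE hEA)

/-! ### Sign-improving windows for every real table -/

/-- **PROVED: the full windowed form of EVERY real table is SIGN-IMPROVING on the finite-energy
class at `0 < a ≤ 1/8`:** `Q^w_a(|u|) ≤ Q^w_a(u)` for every real `u ∈ coreAdm a`. (Table-blind;
`1/8 < 0.30 ≤` every served window.) [folklore] -/
theorem tableClosedForm_abs_le_smallWindow (w : ℕ → ℝ) (hum : Measurable u)
    (hU : coreAdm a (fun x ↦ ((u x : ℝ) : ℂ))) (ha0 : 0 < a) (ha : a ≤ 1 / 8) :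
    tableClosedForm a w (fun x ↦ ((|u x| : ℝ) : ℂ)) ≤
      tableClosedForm a w (fun x ↦ ((u x : ℝ) : ℂ)) := by
  have h := foldGain_ge w hum hU (two_mul_lt_log_two_of_le ha)
  have hgap : 0 < weilArchDensity (2 * a) - 2 * Real.cosh a :=
    sub_pos.2 (two_mul_cosh_lt_weilArchDensity_of_le ha0 ha)
  have hmp0 : 0 ≤ ∫ x, max (u x) 0 := integral_nonneg fun x ↦ le_max_right _ _
  have hmn0 : 0 ≤ ∫ x, max (-u x) 0 := integral_nonneg fun x ↦ le_max_right _ _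
  nlinarith [mul_nonneg hmp0 hmn0]

/-- **PROVED: the full windowed form of EVERY real table is EVEN-SIGN-IMPROVING on the
finite-energy class at `0 < a ≤ 11/40`:** `Q^w_a(|u|) ≤ Q^w_a(u)` for every real EVEN
`u ∈ coreAdm a`. (Table-blind; `11/40 < 0.30 ≤` every served window.) [folklore] -/
theorem tableClosedForm_abs_le_of_even_evenWindow (w : ℕ → ℝ) (hum : Measurable u)
    (hU : coreAdm a (fun x ↦ ((u x : ℝ) : ℂ))) (he : ∀ x, u (-x) = u x) (ha0 : 0 < a)
    (ha : a ≤ 11 / 40) :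
    tableClosedForm a w (fun x ↦ ((|u x| : ℝ) : ℂ)) ≤
      tableClosedForm a w (fun x ↦ ((u x : ℝ) : ℂ)) := by
  have h := evenFoldGain_ge w hum hU he ha0 (two_mul_lt_log_two_of_le_evenWindow ha)
  have hgap : 0 < weilArchDensity a - (1 + Real.cosh a) :=
    sub_pos.2 (one_add_cosh_lt_weilArchDensity_of_le ha0 ha)
  have hmp0 : 0 ≤ ∫ x, max (u x) 0 := integral_nonneg fun x ↦ le_max_right _ _
  have hmn0 : 0 ≤ ∫ x, max (-u x) 0 := integral_nonneg fun x ↦ le_max_right _ _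
  nlinarith [mul_nonneg hmp0 hmn0]

/-- **The equality case (PROVED; parts 4 / 5b recovered from the gain laws).**  If, at such a window,
folding does not lower the form of a real (even) member of the class, the two fold energies are
EQUAL. [folklore] -/
theorem tableClosedForm_abs_eq_of_fold_le_smallWindow (w : ℕ → ℝ) (hum : Measurable u)
    (hU : coreAdm a (fun x ↦ ((u x : ℝ) : ℂ))) (ha0 : 0 < a) (ha : a ≤ 1 / 8)
    (hfold : tableClosedForm a w (fun x ↦ ((u x : ℝ) : ℂ)) ≤
      tableClosedForm a w (fun x ↦ ((|u x| : ℝ) : ℂ))) :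
    tableClosedForm a w (fun x ↦ ((|u x| : ℝ) : ℂ)) =
      tableClosedForm a w (fun x ↦ ((u x : ℝ) : ℂ)) :=
  le_antisymm (tableClosedForm_abs_le_smallWindow w hum hU ha0 ha) hfold

/-- the even-sector equality case at `0 < a ≤ 11/40`. [folklore] -/
theorem tableClosedForm_abs_eq_of_evenFold_le_evenWindow (w : ℕ → ℝ) (hum : Measurable u)
    (hU : coreAdm a (fun x ↦ ((u x : ℝ) : ℂ))) (he : ∀ x, u (-x) = u x) (ha0 : 0 < a)
    (ha : a ≤ 11 / 40)
    (hfold : tableClosedForm a w (fun x ↦ ((u x : ℝ) : ℂ)) ≤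
      tableClosedForm a w (fun x ↦ ((|u x| : ℝ) : ℂ))) :
    tableClosedForm a w (fun x ↦ ((|u x| : ℝ) : ℂ)) =
      tableClosedForm a w (fun x ↦ ((u x : ℝ) : ℂ)) :=
  le_antisymm (tableClosedForm_abs_le_of_even_evenWindow w hum hU he ha0 ha) hfold

end FoldGain

end Summit.RiemannHypothesis.RiemannHypothesis.Theorems.PfPersistence
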